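import Literature.ModelTheory.ExponentialFields.SignDiagramRCF
import HarnessLib

/-!
# Sign diagrams: transfer of realizable sign conditions between two real closed fields

Support file for the discharge of `Literature.ModelTheory.ExponentialFields.tarski_hasQE`
(quantifier elimination for the theory `RCF` of real closed fields). The parametric sign-diagram
theorem of `Literature/ModelTheory/ExponentialFields/SignDiagramRCF.lean`
(`SignDiagramRCF.exists_forall_sign_eval_map_eq`) compares two specializations
`φ, ψ : A → K` of a stable family `P ⊆ A[X]` into *one* real closed field `K`; that is what the
Tarski–Seidenberg projection theorem over `K` needs. Quantifier elimination for the *theory*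
`RCF` needs the same statement for specializations into two *different* models
`φ : A → K`, `ψ : A → K'` (the eliminating quantifier-free formula must be the same in every real
closed field): the set of simultaneous sign conditions on `P` realizable over a point only depends
on the signs of the coefficients at that point, uniformly in the real closed field — which is the
form in which the elimination is printed (Basu–Pollack–Roy 2006, Thm. 2.76 and §2.5.1,
Thm. 2.77: the projection is described by sign conditions "for every real closed field `R`
containing `D`"; Bochnak–Coste–Roy 1998, Thm. 2.2.1 and Prop. 5.2.2; Cohen 1969, whose
"effective" elimination is uniform in the real closed field by construction).

This file redoes the sections *Pairs* and *Param* of `SignDiagramRCF.lean` for pairs of families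
in `K[X] × K'[X]` and correspondences `e : K → K'` between their root sets; the single-field
material (interval and gap lemmas, root sets `rts`, endpoint signs `sigL`/`sigR`, frames, the
bound `exists_bound`) is used from `SignDiagramRCF` for each field separately, and the algebra
over the coefficient ring (`SignDiagram.sprem`, `SignDiagram.IsStable`, …) from `SignDiagram`.
Statements and proofs are otherwise verbatim those of `SignDiagramRCF.lean`.

## Main result

* `SignDiagramRCF.Transfer.exists_forall_sign_eval_map_eq`: for a finite stable family
  `P ⊆ A[X]` and ring homomorphisms `φ : A → K`, `ψ : A → K'` into two real closed fields giving
  the same signs to all coefficients of members of `P`, every simultaneous sign condition on `P`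
  realized at some `y ∈ K` by the `φ`-specializations is realized at some `y' ∈ K'` by the
  `ψ`-specializations.

## References

* S. Basu, R. Pollack, M.-F. Roy, *Algorithms in Real Algebraic Geometry*, 2nd ed., Springer
  (2006): §1.3, Lemma 2.74, Thm. 2.76, Thm. 2.77.
* J. Bochnak, M. Coste, M.-F. Roy, *Real Algebraic Geometry*, Ergebnisse 36, Springer (1998),
  §1.4, Thm. 2.2.1, Prop. 5.2.2.
* P. J. Cohen, Decision procedures for real and `p`-adic fields, Comm. Pure Appl. Math. 22
  (1969), 131–151.
-/

noncomputable section

open Polynomial Set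
open Literature.FieldTheory.RealClosed

namespace Literature.ModelTheory.ExponentialFields

namespace SignDiagramRCF.Transfer

variable {K : Type*} [Field K] [LinearOrder K] {K' : Type*} [Field K'] [LinearOrder K']

/-! ### Pairs of families over two fields and correspondences -/

section Pairs

/-- The family of first components of a finite family of pairs of polynomials. [folklore] -/
def fam₁ (S : Finset (K[X] × K'[X])) : Finset K[X] := S.image Prod.fst

/-- The family of second components of a finite family of pairs of polynomials. [folklore] -/
def fam₂ (S : Finset (K[X] × K'[X])) : Finset K'[X] := S.image Prod.snd

/-- `fam₁` of an insertion. [folklore] -/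
theorem fam₁_insert (S : Finset (K[X] × K'[X])) (p : K[X]) (q : K'[X]) :
    fam₁ (insert (p, q) S) = insert p (fam₁ S) := by
  simp [fam₁, Finset.image_insert]

/-- `fam₂` of an insertion. [folklore] -/
theorem fam₂_insert (S : Finset (K[X] × K'[X])) (p : K[X]) (q : K'[X]) :
    fam₂ (insert (p, q) S) = insert q (fam₂ S) := by
  simp [fam₂, Finset.image_insert]

omit [LinearOrder K'] in
/-- First components belong to `fam₁`. [folklore] -/
theorem fst_mem_fam₁ {S : Finset (K[X] × K'[X])} {pr : K[X] × K'[X]} (h : pr ∈ S) : pr.1 ∈ fam₁ S :=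
  Finset.mem_image_of_mem _ h

omit [LinearOrder K] in
/-- Second components belong to `fam₂`. [folklore] -/
theorem snd_mem_fam₂ {S : Finset (K[X] × K'[X])} {pr : K[X] × K'[X]} (h : pr ∈ S) : pr.2 ∈ fam₂ S :=
  Finset.mem_image_of_mem _ h

/-- Two points `y ∈ K`, `y' ∈ K'` occupy corresponding positions with respect to a map
`e : K → K'` on a finite set `Z ⊆ K`: the elements of `Z` below `y` are exactly those mapped below
`y'`. [folklore] -/
def Corr (e : K → K') (Z : Finset K) (y : K) (y' : K') : Prop := ∀ z ∈ Z, z < y ↔ e z < y'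

/-- A **correspondence** between the two families of a finite family of pairs `S`: an
order-preserving bijection `e` from the root set of the first components onto that of the second
components, matching the signs of each pair at corresponding roots and on corresponding gaps.
This is the combinatorial content of "the two families have the same sign diagram". [folklore] -/
structure IsCorrespondence (S : Finset (K[X] × K'[X])) (e : K → K') : Prop where
  bijOn : Set.BijOn e (rts (fam₁ S)) (rts (fam₂ S))
  strictMonoOn : StrictMonoOn e (rts (fam₁ S))
  sign_root : ∀ pr ∈ S, ∀ z ∈ rts (fam₁ S),
    SignType.sign (pr.1.eval z) = SignType.sign (pr.2.eval (e z))
  sign_gap : ∀ pr ∈ S, ∀ y y', y ∉ rts (fam₁ S) → y' ∉ rts (fam₂ S) →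
    Corr e (rts (fam₁ S)) y y' → SignType.sign (pr.1.eval y) = SignType.sign (pr.2.eval y')

/-- Two families of pairs have **isomorphic sign diagrams** if there is a correspondence.
[folklore] -/
def IsoDiag (S : Finset (K[X] × K'[X])) : Prop := ∃ e : K → K', IsCorrespondence S e

namespace IsCorrespondence

variable {S : Finset (K[X] × K'[X])} {e : K → K'}

/-- A correspondence maps roots to roots. [folklore] -/
theorem mem_of_mem (h : IsCorrespondence S e) {z : K} (hz : z ∈ rts (fam₁ S)) :
    e z ∈ rts (fam₂ S) := h.bijOn.mapsTo hz

/-- A correspondence preserves and reflects `<` on roots. [folklore] -/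
theorem lt_iff_lt (h : IsCorrespondence S e) {z w : K} (hz : z ∈ rts (fam₁ S))
    (hw : w ∈ rts (fam₁ S)) : e z < e w ↔ z < w :=
  h.strictMonoOn.lt_iff_lt hz hw

/-- A correspondence preserves and reflects `≤` on roots. [folklore] -/
theorem le_iff_le (h : IsCorrespondence S e) {z w : K} (hz : z ∈ rts (fam₁ S))
    (hw : w ∈ rts (fam₁ S)) : e z ≤ e w ↔ z ≤ w :=
  h.strictMonoOn.le_iff_le hz hw

/-- Every gap of the first family corresponds to a (non-empty) gap of the second. [folklore] -/
theorem exists_corr [IsStrictOrderedRing K'] (h : IsCorrespondence S e) (y : K) :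
    ∃ y', y' ∉ rts (fam₂ S) ∧ Corr e (rts (fam₁ S)) y y' := by
  classical
  set Z := rts (fam₁ S)
  obtain ⟨y', hB, hA⟩ := exists_between_finsets ((Z.filter (· < y)).image e)
    ((Z.filter fun z => ¬z < y).image e) (by
      intro b hb a ha
      obtain ⟨zb, hzb, rfl⟩ := Finset.mem_image.mp hb
      obtain ⟨za, hza, rfl⟩ := Finset.mem_image.mp ha
      rw [Finset.mem_filter] at hzb hza
      exact (h.lt_iff_lt hzb.1 hza.1).mpr (lt_of_lt_of_le hzb.2 (not_lt.mp hza.2)))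
  refine ⟨y', fun hy' => ?_, fun z hz => ?_⟩
  · obtain ⟨z, hz, rfl⟩ := h.bijOn.surjOn hy'
    by_cases hzy : z < y
    · exact lt_irrefl _ (hB _ (Finset.mem_image_of_mem _ (Finset.mem_filter.mpr ⟨hz, hzy⟩)))
    · exact lt_irrefl _ (hA _ (Finset.mem_image_of_mem _ (Finset.mem_filter.mpr ⟨hz, hzy⟩)))
  · constructor
    · intro hzy
      exact hB _ (Finset.mem_image_of_mem _ (Finset.mem_filter.mpr ⟨hz, hzy⟩))
    · intro hlt
      by_contra hzy
      exact lt_asymm hlt (hA _ (Finset.mem_image_of_mem _ (Finset.mem_filter.mpr ⟨hz, hzy⟩)))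

/-- Every gap of the second family corresponds to a gap of the first. [folklore] -/
theorem exists_corr' [IsStrictOrderedRing K] (h : IsCorrespondence S e) (y' : K') :
    ∃ y, y ∉ rts (fam₁ S) ∧ Corr e (rts (fam₁ S)) y y' := by
  classical
  set Z := rts (fam₁ S)
  obtain ⟨y, hB, hA⟩ := exists_between_finsets (Z.filter fun z => e z < y')
    (Z.filter fun z => ¬e z < y') (by
      intro b hb a ha
      rw [Finset.mem_filter] at hb ha
      by_contra hba
      exact ha.2 (lt_of_le_of_lt ((h.le_iff_le ha.1 hb.1).mpr (not_lt.mp hba)) hb.2))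
  refine ⟨y, fun hy => ?_, fun z hz => ?_⟩
  · by_cases hzy : e y < y'
    · exact lt_irrefl _ (hB _ (Finset.mem_filter.mpr ⟨hy, hzy⟩))
    · exact lt_irrefl _ (hA _ (Finset.mem_filter.mpr ⟨hy, hzy⟩))
  · constructor
    · intro hzy
      by_contra hzy'
      exact lt_asymm hzy (hA _ (Finset.mem_filter.mpr ⟨hz, hzy'⟩))
    · intro hzy'
      exact hB _ (Finset.mem_filter.mpr ⟨hz, hzy'⟩)

/-- Under a correspondence, the roots below corresponding points correspond. [folklore] -/
theorem below_eq_image (h : IsCorrespondence S e) {y : K} {y' : K'}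
    (hc : Corr e (rts (fam₁ S)) y y') :
    below (fam₂ S) y' = (below (fam₁ S) y).image e := by
  ext z'
  simp only [mem_below, Finset.mem_image]
  constructor
  · rintro ⟨hz', hlt⟩
    obtain ⟨z, hz, rfl⟩ := h.bijOn.surjOn hz'
    exact ⟨z, ⟨hz, (hc z hz).mpr hlt⟩, rfl⟩
  · rintro ⟨z, ⟨hz, hlt⟩, rfl⟩
    exact ⟨h.mem_of_mem hz, (hc z hz).mp hlt⟩

/-- Under a correspondence, the roots above corresponding non-roots correspond. [folklore] -/
theorem above_eq_image (h : IsCorrespondence S e) {y : K} {y' : K'} (hy : y ∉ rts (fam₁ S))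
    (hy' : y' ∉ rts (fam₂ S)) (hc : Corr e (rts (fam₁ S)) y y') :
    above (fam₂ S) y' = (above (fam₁ S) y).image e := by
  ext z'
  simp only [mem_above, Finset.mem_image]
  constructor
  · rintro ⟨hz', hlt⟩
    obtain ⟨z, hz, rfl⟩ := h.bijOn.surjOn hz'
    refine ⟨z, ⟨hz, ?_⟩, rfl⟩
    have h1 : ¬z < y := fun hzy => lt_asymm hlt ((hc z hz).mp hzy)
    exact lt_of_le_of_ne (not_lt.mp h1) fun h' => hy (h' ▸ hz)
  · rintro ⟨z, ⟨hz, hlt⟩, rfl⟩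
    refine ⟨h.mem_of_mem hz, ?_⟩
    have h1 : ¬e z < y' := fun h' => lt_asymm hlt ((hc z hz).mpr h')
    exact lt_of_le_of_ne (not_lt.mp h1) fun h' => hy' (h' ▸ h.mem_of_mem hz)

/-- A correspondence commutes with `max'` on sets of roots. [folklore] -/
theorem image_max' (h : IsCorrespondence S e) {B : Finset K} (hB : B ⊆ rts (fam₁ S))
    (hne : B.Nonempty) (hne' : (B.image e).Nonempty) :
    (B.image e).max' hne' = e (B.max' hne) := by
  refine le_antisymm ?_ (Finset.le_max' _ _ (Finset.mem_image_of_mem _ (Finset.max'_mem _ _)))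
  refine Finset.max'_le _ _ _ fun x hx => ?_
  obtain ⟨z, hz, rfl⟩ := Finset.mem_image.mp hx
  exact (h.le_iff_le (hB hz) (hB (Finset.max'_mem _ _))).mpr (Finset.le_max' _ _ hz)

/-- A correspondence commutes with `min'` on sets of roots. [folklore] -/
theorem image_min' (h : IsCorrespondence S e) {B : Finset K} (hB : B ⊆ rts (fam₁ S))
    (hne : B.Nonempty) (hne' : (B.image e).Nonempty) :
    (B.image e).min' hne' = e (B.min' hne) := by
  refine le_antisymm (Finset.min'_le _ _ (Finset.mem_image_of_mem _ (Finset.min'_mem _ _))) ?_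
  refine Finset.le_min' _ _ _ fun x hx => ?_
  obtain ⟨z, hz, rfl⟩ := Finset.mem_image.mp hx
  exact (h.le_iff_le (hB (Finset.min'_mem _ _)) (hB hz)).mpr (Finset.min'_le _ _ hz)

/-- **Transfer of endpoint signs (C3).** For polynomials `p`, `q` of the same degree, the same
sign of leading coefficient and the same signs at corresponding roots, the left endpoint signs of
corresponding gaps agree. [folklore] -/
theorem sigL_eq (h : IsCorrespondence S e) {p : K[X]} {q : K'[X]} (hpq : p.natDegree = q.natDegree)
    (hlc : SignType.sign p.leadingCoeff = SignType.sign q.leadingCoeff)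
    (hroots : ∀ z ∈ rts (fam₁ S), SignType.sign (p.eval z) = SignType.sign (q.eval (e z)))
    {y : K} {y' : K'} (hc : Corr e (rts (fam₁ S)) y y') :
    sigL (fam₂ S) q y' = sigL (fam₁ S) p y := by
  have hbe := h.below_eq_image hc
  have hsub : below (fam₁ S) y ⊆ rts (fam₁ S) := Finset.filter_subset _ _
  unfold sigL
  by_cases hne : (below (fam₁ S) y).Nonempty
  · have hne' : (below (fam₂ S) y').Nonempty := by
      rw [hbe]; exact hne.image _
    rw [dif_pos hne', dif_pos hne]
    have : (below (fam₂ S) y').max' hne' = e ((below (fam₁ S) y).max' hne) := by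
      have hne'' : ((below (fam₁ S) y).image e).Nonempty := hne.image _
      rw [← h.image_max' hsub hne hne'']
      congr 1
    rw [this, hroots _ (hsub (Finset.max'_mem _ _))]
  · have hne' : ¬(below (fam₂ S) y').Nonempty := by
      rw [hbe, Finset.image_nonempty]; exact hne
    rw [dif_neg hne', dif_neg hne]
    simp only [signBot, hpq, hlc]

/-- **Transfer of endpoint signs (C3)**, right endpoints. [folklore] -/
theorem sigR_eq (h : IsCorrespondence S e) {p : K[X]} {q : K'[X]}
    (hlc : SignType.sign p.leadingCoeff = SignType.sign q.leadingCoeff)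
    (hroots : ∀ z ∈ rts (fam₁ S), SignType.sign (p.eval z) = SignType.sign (q.eval (e z)))
    {y : K} {y' : K'} (hy : y ∉ rts (fam₁ S)) (hy' : y' ∉ rts (fam₂ S))
    (hc : Corr e (rts (fam₁ S)) y y') :
    sigR (fam₂ S) q y' = sigR (fam₁ S) p y := by
  have hae := h.above_eq_image hy hy' hc
  have hsub : above (fam₁ S) y ⊆ rts (fam₁ S) := Finset.filter_subset _ _
  unfold sigR
  by_cases hne : (above (fam₁ S) y).Nonempty
  · have hne' : (above (fam₂ S) y').Nonempty := by
      rw [hae]; exact hne.image _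
    rw [dif_pos hne', dif_pos hne]
    have : (above (fam₂ S) y').min' hne' = e ((above (fam₁ S) y).min' hne) := by
      have hne'' : ((above (fam₁ S) y).image e).Nonempty := hne.image _
      rw [← h.image_min' hsub hne hne'']
      congr 1
    rw [this, hroots _ (hsub (Finset.min'_mem _ _))]
  · have hne' : ¬(above (fam₂ S) y').Nonempty := by
      rw [hae, Finset.image_nonempty]; exact hne
    rw [dif_neg hne', dif_neg hne]
    simp only [signTop, hlc]

/-- **Extension theorem** (the Cohen–Hörmander step). Let `e` be a correspondence for `S`, and
let `p`, `q` be polynomials of the same positive degree with leading coefficients of the same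
sign, whose derivatives belong to the respective families, and whose signs at corresponding roots
of the families agree. Then the families extended by the pair `(p, q)` still have isomorphic sign
diagrams: on each gap `p` (resp. `q`) is strictly monotone, so its roots there and its signs
around them are dictated by the endpoint signs of the gap, which correspond.
[cite: BasuPollackRoy2006, Lemma 5.33 (Thom's lemma), proof] -/
theorem isoDiag_insert [IsStrictOrderedRing K] [IsRealClosed K] [IsStrictOrderedRing K']
    [IsRealClosed K'] (h : IsCorrespondence S e) {p : K[X]} {q : K'[X]} (hp : 0 < p.natDegree)
    (hpq : p.natDegree = q.natDegree)
    (hlc : SignType.sign p.leadingCoeff = SignType.sign q.leadingCoeff)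
    (hdp : p.derivative ∈ fam₁ S) (hdq : q.derivative ∈ fam₂ S)
    (hroots : ∀ z ∈ rts (fam₁ S), SignType.sign (p.eval z) = SignType.sign (q.eval (e z))) :
    IsoDiag (insert (p, q) S) := by
  classical
  have hq : 0 < q.natDegree := hpq ▸ hp
  have hp0 : p ≠ 0 := ne_zero_of_natDegree_gt hp
  have hq0 : q ≠ 0 := ne_zero_of_natDegree_gt hq
  have hdp0 : p.derivative ≠ 0 := derivative_ne_zero.mpr hp.ne'
  have hdq0 : q.derivative ≠ 0 := derivative_ne_zero.mpr hq.ne'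
  have hdZ : ∀ r, p.derivative.eval r = 0 → r ∈ rts (fam₁ S) := fun r hr =>
    mem_rts.mpr ⟨_, hdp, hdp0, hr⟩
  have hdZ' : ∀ r, q.derivative.eval r = 0 → r ∈ rts (fam₂ S) := fun r hr =>
    mem_rts.mpr ⟨_, hdq, hdq0, hr⟩
  -- the new root sets
  have hZ1 : ∀ z, z ∈ rts (fam₁ (insert (p, q) S)) ↔ p.eval z = 0 ∨ z ∈ rts (fam₁ S) := by
    intro z; rw [fam₁_insert, mem_rts_insert]; simp [hp0]
  have hZ2 : ∀ z, z ∈ rts (fam₂ (insert (p, q) S)) ↔ q.eval z = 0 ∨ z ∈ rts (fam₂ S) := by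
    intro z; rw [fam₂_insert, mem_rts_insert]; simp [hq0]
  -- transfer of endpoint signs
  have hL : ∀ {y y'}, Corr e (rts (fam₁ S)) y y' → sigL (fam₂ S) q y' = sigL (fam₁ S) p y :=
    fun hc => h.sigL_eq hpq hlc hroots hc
  have hR : ∀ {y y'}, y ∉ rts (fam₁ S) → y' ∉ rts (fam₂ S) → Corr e (rts (fam₁ S)) y y' →
      sigR (fam₂ S) q y' = sigR (fam₁ S) p y :=
    fun hy hy' hc => h.sigR_eq hlc hroots hy hy' hc
  -- new roots of `p` correspond to new roots of `q`
  have hnew : ∀ y, y ∉ rts (fam₁ S) → p.eval y = 0 →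
      ∃ r', r' ∉ rts (fam₂ S) ∧ Corr e (rts (fam₁ S)) y r' ∧ q.eval r' = 0 := by
    intro y hy hy0
    obtain ⟨y', hy', hc⟩ := h.exists_corr y
    have h1 : sigL (fam₁ S) p y = -sigR (fam₁ S) p y ∧ sigL (fam₁ S) p y ≠ 0 :=
      (exists_root_gap_iff hp hdZ hy).mp ⟨y, hy, rfl, hy0⟩
    rw [← hL hc, ← hR hy hy' hc] at h1
    obtain ⟨r', hr', hbr, hr0⟩ := (exists_root_gap_iff hq hdZ' hy').mpr h1
    refine ⟨r', hr', fun z hz => ?_, hr0⟩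
    rw [hc z hz]
    exact (below_eq_below_iff.mp hbr (e z) (h.mem_of_mem hz)).symm
  have hnew' : ∀ y', y' ∉ rts (fam₂ S) → q.eval y' = 0 →
      ∃ r, r ∉ rts (fam₁ S) ∧ Corr e (rts (fam₁ S)) r y' ∧ p.eval r = 0 := by
    intro y' hy' hy0'
    obtain ⟨y, hy, hc⟩ := h.exists_corr' y'
    have h1 : sigL (fam₂ S) q y' = -sigR (fam₂ S) q y' ∧ sigL (fam₂ S) q y' ≠ 0 :=
      (exists_root_gap_iff hq hdZ' hy').mp ⟨y', hy', rfl, hy0'⟩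
    rw [hL hc, hR hy hy' hc] at h1
    obtain ⟨r, hr, hbr, hr0⟩ := (exists_root_gap_iff hp hdZ hy).mpr h1
    refine ⟨r, hr, fun z hz => ?_, hr0⟩
    rw [← hc z hz]
    exact below_eq_below_iff.mp hbr z hz
  -- at most one new root per gap
  have huniq : ∀ y' r₁ r₂, r₁ ∉ rts (fam₁ S) → r₂ ∉ rts (fam₁ S) →
      Corr e (rts (fam₁ S)) r₁ y' → Corr e (rts (fam₁ S)) r₂ y' →
      p.eval r₁ = 0 → p.eval r₂ = 0 → r₁ = r₂ := by
    intro y' r₁ r₂ h₁ h₂ hc₁ hc₂ hp₁ hp₂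
    refine root_gap_unique hp hdZ h₁ h₂ (below_eq_below_iff.mpr fun z hz => ?_) hp₁ hp₂
    rw [hc₁ z hz, hc₂ z hz]
  have huniq' : ∀ y r₁ r₂, r₁ ∉ rts (fam₂ S) → r₂ ∉ rts (fam₂ S) →
      Corr e (rts (fam₁ S)) y r₁ → Corr e (rts (fam₁ S)) y r₂ →
      q.eval r₁ = 0 → q.eval r₂ = 0 → r₁ = r₂ := by
    intro y r₁ r₂ h₁ h₂ hc₁ hc₂ hq₁ hq₂
    refine root_gap_unique hq hdZ' h₁ h₂ (below_eq_below_iff.mpr fun z' hz' => ?_) hq₁ hq₂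
    obtain ⟨z, hz, rfl⟩ := h.bijOn.surjOn hz'
    rw [← hc₁ z hz, ← hc₂ z hz]
  -- the extended map
  obtain ⟨e', he'_old, he'_new⟩ : ∃ e' : K → K', (∀ z ∈ rts (fam₁ S), e' z = e z) ∧
      (∀ y, y ∉ rts (fam₁ S) → p.eval y = 0 →
        e' y ∉ rts (fam₂ S) ∧ Corr e (rts (fam₁ S)) y (e' y) ∧ q.eval (e' y) = 0) := by
    refine ⟨fun y => if y ∈ rts (fam₁ S) then e y else
      if hex : ∃ r', r' ∉ rts (fam₂ S) ∧ Corr e (rts (fam₁ S)) y r' ∧ q.eval r' = 0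
        then hex.choose else e y, fun z hz => by simp [hz], fun y hy hy0 => ?_⟩
    have hex := hnew y hy hy0
    simp only [hy, if_false, dif_pos hex]
    exact hex.choose_spec
  -- basic order facts about `e'`
  have hmono₁ : ∀ a b, a ∈ rts (fam₁ S) → b ∉ rts (fam₁ S) → p.eval b = 0 → a < b →
      e' a < e' b := by
    intro a b ha hb hb0 hab
    rw [he'_old a ha]
    exact ((he'_new b hb hb0).2.1 a ha).mp hab
  have hmono₂ : ∀ a b, a ∉ rts (fam₁ S) → p.eval a = 0 → b ∈ rts (fam₁ S) → a < b →
      e' a < e' b := by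
    intro a b ha ha0 hb hab
    rw [he'_old b hb]
    obtain ⟨haZ', hca, -⟩ := he'_new a ha ha0
    have h1 : ¬e b < e' a := fun h' => lt_asymm hab ((hca b hb).mpr h')
    exact lt_of_le_of_ne (not_lt.mp h1) fun h' => haZ' (h' ▸ h.mem_of_mem hb)
  have hsm : StrictMonoOn e' (rts (fam₁ (insert (p, q) S)) : Set K) := by
    intro a ha b hb hab
    rw [Finset.mem_coe, hZ1] at ha hb
    by_cases haZ : a ∈ rts (fam₁ S) <;> by_cases hbZ : b ∈ rts (fam₁ S)
    · rw [he'_old a haZ, he'_old b hbZ]; exact (h.lt_iff_lt haZ hbZ).mpr hab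
    · exact hmono₁ a b haZ hbZ (hb.resolve_right hbZ) hab
    · exact hmono₂ a b haZ (ha.resolve_right haZ) hbZ hab
    · have ha0 := ha.resolve_right haZ
      have hb0 := hb.resolve_right hbZ
      by_cases hmid : ∃ z ∈ rts (fam₁ S), a < z ∧ z < b
      · obtain ⟨z, hz, haz, hzb⟩ := hmid
        exact (hmono₂ a z haZ ha0 hz haz).trans (hmono₁ z b hz hbZ hb0 hzb)
      · push Not at hmid
        exfalso
        have hbel : below (fam₁ S) b = below (fam₁ S) a := by
          refine below_eq_below_iff.mpr fun z hz => ⟨fun hzb => ?_, fun hza => hza.trans hab⟩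
          by_contra hza
          have haz : a < z := lt_of_le_of_ne (not_lt.mp hza) (fun h' => haZ (h' ▸ hz))
          exact absurd hzb (not_lt.mpr (hmid z hz haz))
        exact absurd (root_gap_unique hp hdZ haZ hbZ hbel ha0 hb0) hab.ne
  refine ⟨e', ⟨fun z hz => ?_, hsm.injOn, fun z' hz' => ?_⟩, hsm, ?_, ?_⟩
  · -- maps to
    rw [Finset.mem_coe] at hz ⊢
    rw [hZ2]
    by_cases hzZ : z ∈ rts (fam₁ S)
    · exact Or.inr (he'_old z hzZ ▸ h.mem_of_mem hzZ)
    · have hz0 : p.eval z = 0 := ((hZ1 z).mp hz).resolve_right hzZ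
      exact Or.inl (he'_new z hzZ hz0).2.2
  · -- surjective
    rw [Finset.mem_coe, hZ2] at hz'
    by_cases hzZ' : z' ∈ rts (fam₂ S)
    · obtain ⟨z, hz, rfl⟩ := h.bijOn.surjOn hzZ'
      exact ⟨z, by rw [Finset.mem_coe, hZ1]; exact Or.inr hz, he'_old z hz⟩
    · have hz0' : q.eval z' = 0 := hz'.resolve_right hzZ'
      obtain ⟨r, hr, hcr, hr0⟩ := hnew' z' hzZ' hz0'
      refine ⟨r, by rw [Finset.mem_coe, hZ1]; exact Or.inl hr0, ?_⟩
      obtain ⟨hrZ', hcr', hr0'⟩ := he'_new r hr hr0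
      exact huniq' r _ _ hrZ' hzZ' hcr' hcr hr0' hz0'
  · -- signs at roots
    intro pr hpr z hz
    rw [hZ1] at hz
    rw [Finset.mem_insert] at hpr
    by_cases hzZ : z ∈ rts (fam₁ S)
    · rw [he'_old z hzZ]
      rcases hpr with rfl | hpr
      · exact hroots z hzZ
      · exact h.sign_root pr hpr z hzZ
    · have hz0 : p.eval z = 0 := hz.resolve_right hzZ
      obtain ⟨hzZ', hcz, hz0'⟩ := he'_new z hzZ hz0
      rcases hpr with rfl | hpr
      · simp only [hz0, hz0', sign_zero]
      · exact h.sign_gap pr hpr z (e' z) hzZ hzZ' hcz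
  · -- signs on gaps
    intro pr hpr y y' hy hy' hc'
    rw [hZ1, not_or] at hy
    rw [hZ2, not_or] at hy'
    obtain ⟨hyp, hyZ⟩ := hy
    obtain ⟨hyq, hyZ'⟩ := hy'
    have hc : Corr e (rts (fam₁ S)) y y' := fun z hz => by
      rw [← he'_old z hz]; exact hc' z ((hZ1 z).mpr (Or.inr hz))
    rw [Finset.mem_insert] at hpr
    rcases hpr with rfl | hpr
    swap
    · exact h.sign_gap pr hpr y y' hyZ hyZ' hc
    · dsimp only
      by_cases hex : ∃ r, r ∉ rts (fam₁ S) ∧ below (fam₁ S) r = below (fam₁ S) y ∧ p.eval r = 0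
      · obtain ⟨r, hr, hbr, hr0⟩ := hex
        rw [sign_gap_of_root hp hdZ hyZ hyp hr hbr hr0]
        obtain ⟨hrZ', hcr, hr0'⟩ := he'_new r hr hr0
        have hbr' : below (fam₂ S) (e' r) = below (fam₂ S) y' := by
          refine below_eq_below_iff.mpr fun z' hz' => ?_
          obtain ⟨z, hz, rfl⟩ := h.bijOn.surjOn hz'
          rw [← hcr z hz, ← hc z hz]
          exact below_eq_below_iff.mp hbr z hz
        rw [sign_gap_of_root hq hdZ' hyZ' hyq hrZ' hbr' hr0', hL hc, hR hyZ hyZ' hc]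
        have h1 := hc' r ((hZ1 r).mpr (Or.inl hr0))
        have hyr : y ≠ r := fun h' => hyp (h' ▸ hr0)
        have hyr' : y' ≠ e' r := fun h' => hyq (h' ▸ hr0')
        have hiff : y < r ↔ y' < e' r := by
          constructor
          · intro hlt
            by_contra hge
            exact lt_asymm hlt (h1.mpr (lt_of_le_of_ne (not_lt.mp hge) hyr'.symm))
          · intro hlt
            by_contra hge
            exact lt_asymm hlt (h1.mp (lt_of_le_of_ne (not_lt.mp hge) hyr.symm))
        simp only [hiff]
      · push Not at hex
        rw [sign_gap_of_no_root hp hdZ hyZ hex]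
        have hex' : ∀ r', r' ∉ rts (fam₂ S) → below (fam₂ S) r' = below (fam₂ S) y' →
            q.eval r' ≠ 0 := by
          intro r' hr' hbr' hq0'
          obtain ⟨r, hr, hcr, hr0⟩ := hnew' r' hr' hq0'
          refine hex r hr ?_ hr0
          refine below_eq_below_iff.mpr fun z hz => ?_
          rw [hcr z hz, hc z hz]
          exact below_eq_below_iff.mp hbr' (e z) (h.mem_of_mem hz)
        rw [sign_gap_of_no_root hq hdZ' hyZ' hex', hL hc, hR hyZ hyZ' hc]

/-- **Transfer of realized sign conditions.** Under a correspondence, every simultaneous sign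
condition realized by the first components at some point is realized by the second components at
some (corresponding) point. [folklore] -/
theorem exists_sign_eq [IsStrictOrderedRing K'] (h : IsCorrespondence S e) (y : K) :
    ∃ y', ∀ pr ∈ S, SignType.sign (pr.1.eval y) = SignType.sign (pr.2.eval y') := by
  by_cases hy : y ∈ rts (fam₁ S)
  · exact ⟨e y, fun pr hpr => h.sign_root pr hpr y hy⟩
  · obtain ⟨y', hy', hc⟩ := h.exists_corr y
    exact ⟨y', fun pr hpr => h.sign_gap pr hpr y y' hy hy' hc⟩

end IsCorrespondence

/-- **Base case.** A family of pairs of constant polynomials with matching signs has isomorphic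
sign diagrams (both root sets are empty). [folklore] -/
theorem isoDiag_of_natDegree_eq_zero {S : Finset (K[X] × K'[X])}
    (h : ∀ pr ∈ S, pr.1.natDegree = 0 ∧ pr.2.natDegree = 0 ∧
      SignType.sign (pr.1.coeff 0) = SignType.sign (pr.2.coeff 0)) :
    IsoDiag S := by
  have hc : ∀ pr ∈ S, ∀ y y', SignType.sign (pr.1.eval y) = SignType.sign (pr.2.eval y') := by
    intro pr hpr y y'
    obtain ⟨h1, h2, h3⟩ := h pr hpr
    rw [eq_C_of_natDegree_eq_zero h1, eq_C_of_natDegree_eq_zero h2, eval_C, eval_C, h3]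
  have hZ1 : rts (fam₁ S) = ∅ := by
    refine Finset.eq_empty_of_forall_notMem fun z hz => ?_
    obtain ⟨f, hf, hf0, hfz⟩ := mem_rts.mp hz
    obtain ⟨pr, hpr, rfl⟩ := Finset.mem_image.mp hf
    obtain ⟨h1, -, -⟩ := h pr hpr
    rw [eq_C_of_natDegree_eq_zero h1, eval_C] at hfz
    exact hf0 (by rw [eq_C_of_natDegree_eq_zero h1, hfz, C_0])
  have hZ2 : rts (fam₂ S) = ∅ := by
    refine Finset.eq_empty_of_forall_notMem fun z hz => ?_
    obtain ⟨f, hf, hf0, hfz⟩ := mem_rts.mp hz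
    obtain ⟨pr, hpr, rfl⟩ := Finset.mem_image.mp hf
    obtain ⟨-, h2, -⟩ := h pr hpr
    rw [eq_C_of_natDegree_eq_zero h2, eval_C] at hfz
    exact hf0 (by rw [eq_C_of_natDegree_eq_zero h2, hfz, C_0])
  refine ⟨fun _ => 0, ⟨fun z hz => ?_, fun z hz => ?_, fun z hz => ?_⟩, fun z hz => ?_,
    fun pr hpr z _ => hc pr hpr z _, fun pr hpr y y' _ _ _ => hc pr hpr y y'⟩
  · simp [hZ1] at hz
  · simp [hZ1] at hz
  · simp [hZ2] at hz
  · simp [hZ1] at hz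

/-- Realized sign conditions transfer along isomorphic sign diagrams. [folklore] -/
theorem IsoDiag.exists_sign_eq [IsStrictOrderedRing K']
    {S : Finset (K[X] × K'[X])} (h : IsoDiag S) (y : K) :
    ∃ y', ∀ pr ∈ S, SignType.sign (pr.1.eval y) = SignType.sign (pr.2.eval y') := by
  obtain ⟨e, he⟩ := h
  exact he.exists_sign_eq y

end Pairs

/-! ### Parametric sign diagrams over two real closed fields -/

section Param

variable {A : Type*} [CommRing A]

/-- The finite family of pairs of specializations of a family `P ⊆ A[X]` under two ring
homomorphisms `φ : A → K`, `ψ : A → K'` into two fields.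
[cite: BasuPollackRoy2006, §1.3, Notation 1.18 (specialization Q_y), p. 22] -/
def specPairs (P : Finset A[X]) (φ : A →+* K) (ψ : A →+* K') : Finset (K[X] × K'[X]) :=
  P.image fun f => (f.map φ, f.map ψ)

/-- Members of `P` give pairs of specializations.
[cite: BasuPollackRoy2006, §1.3, Notation 1.18 (specialization Q_y), p. 22] -/
theorem mem_specPairs {P : Finset A[X]} {φ : A →+* K} {ψ : A →+* K'} {f : A[X]} (hf : f ∈ P) :
    (f.map φ, f.map ψ) ∈ specPairs P φ ψ :=
  Finset.mem_image_of_mem _ hf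

/-- The first components of `specPairs P φ ψ` are the `φ`-specializations.
[cite: BasuPollackRoy2006, §1.3, Notation 1.18 (specialization Q_y), p. 22] -/
theorem fam₁_specPairs (P : Finset A[X]) (φ : A →+* K) (ψ : A →+* K') :
    fam₁ (specPairs P φ ψ) = P.image fun f => f.map φ := by
  rw [fam₁, specPairs, Finset.image_image]; rfl

/-- The second components of `specPairs P φ ψ` are the `ψ`-specializations.
[cite: BasuPollackRoy2006, §1.3, Notation 1.18 (specialization Q_y), p. 22] -/
theorem fam₂_specPairs (P : Finset A[X]) (φ : A →+* K) (ψ : A →+* K') :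
    fam₂ (specPairs P φ ψ) = P.image fun f => f.map ψ := by
  rw [fam₂, specPairs, Finset.image_image]; rfl

/-- `specPairs` of an insertion.
[cite: BasuPollackRoy2006, §1.3, Notation 1.18 (specialization Q_y), p. 22] -/
theorem specPairs_insert [DecidableEq A] (P : Finset A[X]) (φ : A →+* K) (ψ : A →+* K')
    (p : A[X]) :
    specPairs (insert p P) φ ψ = insert (p.map φ, p.map ψ) (specPairs P φ ψ) := by
  rw [specPairs, Finset.image_insert]; rfl

/-- **Root transfer.** In the inductive step (removing a member `p` of maximal positive degree from
a stable family `P`), the signs of the two specializations of `p` agree at corresponding roots of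
the smaller families: at a root `z` of `g_φ` (`g ∈ P ∖ {p}`, normalized so that its leading
coefficient does not vanish under `φ`), the pseudo-remainder identity expresses `p_φ(z)` through
the specialization of `SignDiagram.sprem p g`, a member of `P ∖ {p}`.
[cite: BasuPollackRoy2006, §1.3, Notation 1.18 (specialization Q_y), p. 22] -/
theorem sign_map_eval_eq_of_mem_rts [IsStrictOrderedRing K] [IsStrictOrderedRing K']
    [DecidableEq A] {P : Finset A[X]} (hP : SignDiagram.IsStable P)
    {φ : A →+* K} {ψ : A →+* K'}
    (hsign : ∀ f ∈ P, ∀ i, SignType.sign (φ (f.coeff i)) = SignType.sign (ψ (f.coeff i)))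
    {p : A[X]} (hpP : p ∈ P) (hd : 0 < p.natDegree) (hmax : ∀ f ∈ P, f.natDegree ≤ p.natDegree)
    {e : K → K'} (he : IsCorrespondence (specPairs (P.erase p) φ ψ) e)
    {z : K} (hz : z ∈ rts (fam₁ (specPairs (P.erase p) φ ψ))) :
    SignType.sign ((p.map φ).eval z) = SignType.sign ((p.map ψ).eval (e z)) := by
  set P' := P.erase p with hP'def
  have hP'sub : ∀ f ∈ P', f ∈ P := fun f hf => Finset.mem_of_mem_erase hf
  have hP' : SignDiagram.IsStable P' := hP.erase hd hmax
  -- a member `g ∈ P'` with `g_φ ≠ 0`, `g_φ(z) = 0`, normalized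
  obtain ⟨F, hF, hF0, hFz⟩ := mem_rts.mp hz
  rw [fam₁_specPairs] at hF
  obtain ⟨g, hgP', rfl⟩ := Finset.mem_image.mp hF
  obtain ⟨g', hg'P', hmap, hlc, hdeg⟩ := hP'.exists_map_eq φ hgP' hF0
  have hg'P : g' ∈ P := hP'sub g' hg'P'
  have hm : 0 < g'.natDegree := by
    rw [← natDegree_map_of_leadingCoeff_ne_zero φ hlc, hmap]
    exact natDegree_pos_iff_degree_pos.mpr (degree_pos_of_root hF0 hFz)
  have hmp : g'.natDegree ≤ p.natDegree := hdeg.trans (hmax g (hP'sub g hgP'))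
  have hlt : (SignDiagram.sprem p g').natDegree < p.natDegree := (SignDiagram.natDegree_sprem_lt hm).trans_le hmp
  have hSP' : SignDiagram.sprem p g' ∈ P' :=
    Finset.mem_erase.mpr ⟨fun h => lt_irrefl _ (h ▸ hlt), hP.sprem_mem hpP hg'P hm hmp⟩
  -- signs of the leading coefficient of `g'`
  have hslc : SignType.sign (φ g'.leadingCoeff) = SignType.sign (ψ g'.leadingCoeff) := by
    have := hsign g' hg'P g'.natDegree
    rwa [coeff_natDegree] at this
  have hlcψ : ψ g'.leadingCoeff ≠ 0 := by
    intro h0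
    rw [h0, sign_zero, sign_eq_zero_iff] at hslc
    exact hlc hslc
  -- `z` and `e z` are roots of the specializations of `g'`
  have hzφ : g'.eval₂ φ z = 0 := by rw [← eval_map, hmap]; exact hFz
  have hzψ : g'.eval₂ ψ (e z) = 0 := by
    have h1 := he.sign_root _ (mem_specPairs hg'P') z hz
    dsimp only at h1
    rw [hmap, hFz, sign_zero, eq_comm, sign_eq_zero_iff, eval_map] at h1
    exact h1
  -- pseudo-remainder identities and the correspondence for `SignDiagram.sprem p g'`
  have hidφ := SignDiagram.eval₂_sprem φ (p := p) hm hzφ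
  have hidψ := SignDiagram.eval₂_sprem ψ (p := p) hm hzψ
  have h2 := he.sign_root _ (mem_specPairs hSP') z hz
  dsimp only at h2
  rw [eval_map, eval_map] at h2
  rw [eval_map, eval_map, sign_eq_of_eq_pow_mul hlc hidφ, sign_eq_of_eq_pow_mul hlcψ hidψ, h2, hslc]

/-- **Parametric sign-diagram theorem** (Cohen–Hörmander, in Muchnik's form). Let `P ⊆ A[X]` be a
finite stable family and `φ, ψ : A → K` two ring homomorphisms giving the same sign to every
coefficient of every member of `P`. Then the specialized families `{f_φ}` and `{f_ψ}` have
isomorphic sign diagrams. Induction on `P`, removing a member of maximal degree.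
[Bochnak–Coste–Roy 1998, proof of Thm. 2.2.1 / §1.4; Michaux–Ozturk 2002]
[cite: BasuPollackRoy2006, Lemma 2.74 and Thm. 2.76] -/
theorem isoDiag_specPairs [IsStrictOrderedRing K] [IsRealClosed K] [IsStrictOrderedRing K']
    [IsRealClosed K'] (φ : A →+* K) (ψ : A →+* K') (P : Finset A[X])
    (hP : SignDiagram.IsStable P)
    (hsign : ∀ f ∈ P, ∀ i, SignType.sign (φ (f.coeff i)) = SignType.sign (ψ (f.coeff i))) :
    IsoDiag (specPairs P φ ψ) := by
  classical
  induction P using Finset.strongInduction with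
  | H P ih =>
    by_cases hpos : ∃ f ∈ P, 0 < f.natDegree
    · obtain ⟨f₀, hf₀, hf₀d⟩ := hpos
      obtain ⟨p, hpP, hmax⟩ := Finset.exists_max_image P natDegree ⟨f₀, hf₀⟩
      have hd : 0 < p.natDegree := hf₀d.trans_le (hmax f₀ hf₀)
      set P' := P.erase p with hP'def
      have hP' : SignDiagram.IsStable P' := hP.erase hd hmax
      have hsub : P' ⊂ P := Finset.erase_ssubset hpP
      have hsign' : ∀ f ∈ P', ∀ i,
          SignType.sign (φ (f.coeff i)) = SignType.sign (ψ (f.coeff i)) :=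
        fun f hf i => hsign f (Finset.mem_of_mem_erase hf) i
      obtain ⟨e, he⟩ := ih P' hsub hP' hsign'
      have hPins : specPairs P φ ψ = insert (p.map φ, p.map ψ) (specPairs P' φ ψ) := by
        rw [← specPairs_insert, Finset.insert_erase hpP]
      rw [hPins]
      have hslc : SignType.sign (φ p.leadingCoeff) = SignType.sign (ψ p.leadingCoeff) := by
        have := hsign p hpP p.natDegree
        rwa [coeff_natDegree] at this
      by_cases hlc : φ p.leadingCoeff = 0
      · -- the leading coefficient vanishes under both specializations: `p` specializes like
        -- `eraseLead p ∈ P'`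
        have hlc' : ψ p.leadingCoeff = 0 := by
          rw [hlc, sign_zero, eq_comm, sign_eq_zero_iff] at hslc; exact hslc
        have hE : eraseLead p ∈ P' := by
          refine Finset.mem_erase.mpr ⟨fun h => ?_, hP.eraseLead_mem hpP⟩
          rcases eraseLead_natDegree_lt_or_eraseLead_eq_zero p with hlt | h0
          · rw [h] at hlt; exact lt_irrefl _ hlt
          · rw [h0] at h; rw [← h] at hd; simp at hd
        have hmem := mem_specPairs (φ := φ) (ψ := ψ) hE
        rw [SignDiagram.map_eraseLead_of_apply_leadingCoeff φ hlc,
          SignDiagram.map_eraseLead_of_apply_leadingCoeff ψ hlc'] at hmem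
        rw [Finset.insert_eq_of_mem hmem]
        exact ⟨e, he⟩
      · have hlcψ : ψ p.leadingCoeff ≠ 0 := by
          intro h0
          rw [h0, sign_zero, sign_eq_zero_iff] at hslc
          exact hlc hslc
        have hder : derivative p ∈ P' := by
          refine Finset.mem_erase.mpr ⟨fun h => ?_, hP.derivative_mem hpP⟩
          have := natDegree_derivative_lt hd.ne'
          rw [h] at this
          exact lt_irrefl _ this
        refine he.isoDiag_insert ?_ ?_ ?_ ?_ ?_ ?_
        · rw [natDegree_map_of_leadingCoeff_ne_zero φ hlc]; exact hd
        · rw [natDegree_map_of_leadingCoeff_ne_zero φ hlc,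
            natDegree_map_of_leadingCoeff_ne_zero ψ hlcψ]
        · rw [leadingCoeff_map_of_leadingCoeff_ne_zero φ hlc,
            leadingCoeff_map_of_leadingCoeff_ne_zero ψ hlcψ, hslc]
        · rw [derivative_map, fam₁_specPairs]
          exact Finset.mem_image_of_mem _ hder
        · rw [derivative_map, fam₂_specPairs]
          exact Finset.mem_image_of_mem _ hder
        · intro z hz
          exact sign_map_eval_eq_of_mem_rts hP hsign hpP hd hmax he hz
    · push Not at hpos
      refine isoDiag_of_natDegree_eq_zero fun pr hpr => ?_
      obtain ⟨f, hf, rfl⟩ := Finset.mem_image.mp hpr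
      have hf0 : f.natDegree = 0 := Nat.le_zero.mp (hpos f hf)
      refine ⟨Nat.le_zero.mp (natDegree_map_le.trans hf0.le),
        Nat.le_zero.mp (natDegree_map_le.trans hf0.le), ?_⟩
      dsimp only
      rw [coeff_map, coeff_map]
      exact hsign f hf 0

/-- **Transfer of realizable sign conditions.** Under the hypotheses of `isoDiag_specPairs`, every
simultaneous sign condition on the members of `P` realized by the `φ`-specializations at some real
point is realized by the `ψ`-specializations at some real point.
[cite: BasuPollackRoy2006, Lemma 2.74 and Thm. 2.76] -/
theorem exists_forall_sign_eval_map_eq [IsStrictOrderedRing K] [IsRealClosed K]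
    [IsStrictOrderedRing K'] [IsRealClosed K'] (φ : A →+* K) (ψ : A →+* K') (P : Finset A[X])
    (hP : SignDiagram.IsStable P)
    (hsign : ∀ f ∈ P, ∀ i, SignType.sign (φ (f.coeff i)) = SignType.sign (ψ (f.coeff i)))
    (y : K) : ∃ y' : K', ∀ f ∈ P,
      SignType.sign ((f.map φ).eval y) = SignType.sign ((f.map ψ).eval y') := by
  obtain ⟨y', hy'⟩ := (isoDiag_specPairs φ ψ P hP hsign).exists_sign_eq y
  exact ⟨y', fun f hf => hy' _ (mem_specPairs hf)⟩

end Param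

end SignDiagramRCF.Transfer

end Literature.ModelTheory.ExponentialFields
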